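import Mathlib

/-!
# Solo-blind kernel #106 — an exact quartic (neutral-leaf) landing of the two-hump model profile

Steady-door programme (solo-blind), paper §24.57.  After kernel #105 (`SoloBlindQuinticLanding`:
the one-hump similarity class admits no jump-free landing) the low branch was redesigned to land
with contact order four on the downstream *neutral leaf* `x_e` (a zero of the reduced growth `S`)
of a DIMPLED-RIDGE profile.  In the linear-response outer model the pattern intensity obeys
`q''' = p := -S` with a cubic lift-off `q = q' = q'' = 0` at `x₀` (`S(x₀) < 0`), and the jump-free
landing `q = q' = q'' = 0` at `x_e` is the vanishing of the three moments
`M_k = ∫_{x₀}^{x_e} (x_e - t)^k p(t) dt`, `k = 0, 1, 2` — three conditions for the one unknown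
`x₀`: codimension two, paid by the two running dials `(ν_j, U_j)` of the steady door.

Here we certify that the two-hump model family actually contains such a landing, EXACTLY:
with `r = √6`, the profile `S(t) = 31/60 - (t² - 1)² - (4r/45)·t` (humps near `∓1`, a dip at `0`,
tilted by `e = -4√6/45`), lift-off `x₀ = -(2/3)√6` and landing `x_e = √6/2` satisfy
* `S(x_e) = 0` with `S(t) = (x_e - t)·D(t)`, `D(x_e) = 49√6/45 > 0` (a simple zero, live side
  upstream, dead side downstream), `S(x₀) = -343/180 < 0` (stable leaf at lift-off), and the sign
  pattern `S(-1) > 0`, `S(0) < 0`, `S(1) > 0` (the ≥ 3 sign changes required by §24.57(2));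
* `M_0 = M_1 = M_2 = 0`, the moments being identified with the interval integrals of
  `(x_e - t)^k · p(t)`.
All identities are polynomial identities in `r` modulo `r² = 6` (found numerically in
`work/k4/moments.py`, s57; recognised and checked in `ℚ(√6)` in `work/k4/exact_k4.py`, s58).
(Positivity of `q` on the open live interval and the non-degeneracy of the 3×3 Jacobian are
computed facts, not formalised here.)
-/

namespace Summit.AnomalousDissipation.AnomalousDissipation.Theorems

open intervalIntegral

/-- The two-hump model reduced-growth profile, with the tilt written through a parameter `r`
(`r = √6` at the landing): `S(t) = 31/60 - (t² - 1)² - (4r/45) t`. -/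
noncomputable def humpS (r t : ℝ) : ℝ := 31 / 60 - (t ^ 2 - 1) ^ 2 - (4 * r / 45) * t

/-- The load of the linear-response outer model, `q''' = p = -S`. -/
noncomputable def humpLoad (r t : ℝ) : ℝ := -humpS r t

/-- The cofactor of the downstream zero: `S(t) = (r/2 - t) · D(t)` when `r² = 6`. -/
noncomputable def humpSlopeFactor (r t : ℝ) : ℝ :=
  (t + r / 2) * (t ^ 2 + (r / 2) ^ 2) - 2 * (t + r / 2) + 4 * r / 45

/-- Antiderivative of `p`. -/
noncomputable def humpPrim0 (r t : ℝ) : ℝ :=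
  t ^ 5 / 5 - 2 * t ^ 3 / 3 + 29 * t / 60 + (2 * r / 45) * t ^ 2

/-- Antiderivative of `t · p`. -/
noncomputable def humpPrim1 (r t : ℝ) : ℝ :=
  t ^ 6 / 6 - t ^ 4 / 2 + 29 * t ^ 2 / 120 + (4 * r / 135) * t ^ 3

/-- Antiderivative of `t² · p`. -/
noncomputable def humpPrim2 (r t : ℝ) : ℝ :=
  t ^ 7 / 7 - 2 * t ^ 5 / 5 + 29 * t ^ 3 / 180 + (r / 45) * t ^ 4

/-- Closed form of the landing moment `M₀(a,b) = ∫_a^b p`. -/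
noncomputable def quarticMoment0 (r a b : ℝ) : ℝ := humpPrim0 r b - humpPrim0 r a

/-- Closed form of `M₁(a,b) = ∫_a^b (b - t) p(t) dt`. -/
noncomputable def quarticMoment1 (r a b : ℝ) : ℝ :=
  b * (humpPrim0 r b - humpPrim0 r a) - (humpPrim1 r b - humpPrim1 r a)

/-- Closed form of `M₂(a,b) = ∫_a^b (b - t)² p(t) dt`. -/
noncomputable def quarticMoment2 (r a b : ℝ) : ℝ :=
  b ^ 2 * (humpPrim0 r b - humpPrim0 r a) - 2 * b * (humpPrim1 r b - humpPrim1 r a)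
    + (humpPrim2 r b - humpPrim2 r a)

/-! ### The profile: neutral leaf downstream, stable leaf at lift-off, two humps -/

/-- Factorisation at the downstream contact: `S(t) = (r/2 - t) D(t)` (given `r² = 6`). -/
theorem humpS_factor (r t : ℝ) (hr : r ^ 2 = 6) :
    humpS r t = (r / 2 - t) * humpSlopeFactor r t := by
  unfold humpS humpSlopeFactor
  linear_combination (29 / 360 - r ^ 2 / 16) * hr

/-- The downstream contact `x_e = r/2` is a zero of `S` (the neutral leaf). -/
theorem humpS_landing_zero (r : ℝ) (hr : r ^ 2 = 6) : humpS r (r / 2) = 0 := by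
  rw [humpS_factor r _ hr]; ring

/-- It is a simple zero with negative slope: `D(x_e) = 49 r / 45` (`> 0` for `r = √6`), so `S > 0`
just upstream and `S < 0` just downstream of `x_e`. -/
theorem humpSlopeFactor_at_landing (r : ℝ) (hr : r ^ 2 = 6) :
    humpSlopeFactor r (r / 2) = 49 * r / 45 := by
  unfold humpSlopeFactor
  linear_combination (r / 2) * hr

/-- The lift-off leaf is stable: `S(x₀) = -343/180` at `x₀ = -(2/3) r`. -/
theorem humpS_liftoff (r : ℝ) (hr : r ^ 2 = 6) : humpS r (-(2 / 3) * r) = -(343 / 180) := by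
  unfold humpS
  linear_combination (-(32 : ℝ) / 135 - 16 * r ^ 2 / 81) * hr

/-- Sign pattern on the live interval (two humps and a dip) and a dead leaf beyond the contact,
for any tilt parameter `0 < r < 3` (in particular `r = √6`). -/
theorem humpS_sign_pattern (r : ℝ) (hr0 : 0 < r) (hr3 : r < 3) :
    0 < humpS r (-1) ∧ humpS r 0 < 0 ∧ 0 < humpS r 1 ∧ humpS r (3 / 2) < 0 := by
  unfold humpS
  refine ⟨?_, ?_, ?_, ?_⟩ <;> nlinarith

/-! ### The moments as interval integrals -/

/-- A four-monomial interval integral in closed form. -/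
theorem integral_four_monomials (a b c₁ c₂ c₃ c₄ : ℝ) (n₁ n₂ n₃ n₄ : ℕ) :
    ∫ t in a..b, (c₁ * t ^ n₁ + c₂ * t ^ n₂ + c₃ * t ^ n₃ + c₄ * t ^ n₄) =
      c₁ * ((b ^ (n₁ + 1) - a ^ (n₁ + 1)) / (n₁ + 1))
        + c₂ * ((b ^ (n₂ + 1) - a ^ (n₂ + 1)) / (n₂ + 1))
        + c₃ * ((b ^ (n₃ + 1) - a ^ (n₃ + 1)) / (n₃ + 1))
        + c₄ * ((b ^ (n₄ + 1) - a ^ (n₄ + 1)) / (n₄ + 1)) := by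
  rw [integral_add (by apply Continuous.intervalIntegrable; fun_prop)
        (by apply Continuous.intervalIntegrable; fun_prop),
    integral_add (by apply Continuous.intervalIntegrable; fun_prop)
        (by apply Continuous.intervalIntegrable; fun_prop),
    integral_add (by apply Continuous.intervalIntegrable; fun_prop)
        (by apply Continuous.intervalIntegrable; fun_prop),
    intervalIntegral.integral_const_mul, intervalIntegral.integral_const_mul,
    intervalIntegral.integral_const_mul, intervalIntegral.integral_const_mul,
    integral_pow, integral_pow, integral_pow, integral_pow]

/-- `∫_a^b p = P₀(b) - P₀(a)`. -/
theorem integral_humpLoad (r a b : ℝ) :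
    ∫ t in a..b, humpLoad r t = humpPrim0 r b - humpPrim0 r a := by
  rw [intervalIntegral.integral_congr
        (g := fun t => (1 : ℝ) * t ^ 4 + (-2) * t ^ 2 + (4 * r / 45) * t ^ 1 + (29 / 60) * t ^ 0)
        (fun t _ => by simp only [humpLoad, humpS]; ring),
    integral_four_monomials]
  unfold humpPrim0; push_cast; ring

/-- `∫_a^b t·p(t) dt = P₁(b) - P₁(a)`. -/
theorem integral_mul_humpLoad (r a b : ℝ) :
    ∫ t in a..b, t * humpLoad r t = humpPrim1 r b - humpPrim1 r a := by
  rw [intervalIntegral.integral_congr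
        (g := fun t => (1 : ℝ) * t ^ 5 + (-2) * t ^ 3 + (4 * r / 45) * t ^ 2 + (29 / 60) * t ^ 1)
        (fun t _ => by simp only [humpLoad, humpS]; ring),
    integral_four_monomials]
  unfold humpPrim1; push_cast; ring

/-- `∫_a^b t²·p(t) dt = P₂(b) - P₂(a)`. -/
theorem integral_sq_mul_humpLoad (r a b : ℝ) :
    ∫ t in a..b, t ^ 2 * humpLoad r t = humpPrim2 r b - humpPrim2 r a := by
  rw [intervalIntegral.integral_congr
        (g := fun t => (1 : ℝ) * t ^ 6 + (-2) * t ^ 4 + (4 * r / 45) * t ^ 3 + (29 / 60) * t ^ 2)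
        (fun t _ => by simp only [humpLoad, humpS]; ring),
    integral_four_monomials]
  unfold humpPrim2; push_cast; ring

/-- `M₀` is the interval integral of the load. -/
theorem quarticMoment0_eq_integral (r a b : ℝ) :
    ∫ t in a..b, humpLoad r t = quarticMoment0 r a b := by
  rw [integral_humpLoad]; rfl

/-- `M₁(a,b) = ∫_a^b (b - t) p(t) dt`. -/
theorem quarticMoment1_eq_integral (r a b : ℝ) :
    ∫ t in a..b, (b - t) * humpLoad r t = quarticMoment1 r a b := by
  rw [intervalIntegral.integral_congr (g := fun t => b * humpLoad r t - t * humpLoad r t)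
        (fun t _ => by ring),
    integral_sub (by apply Continuous.intervalIntegrable; unfold humpLoad humpS; fun_prop)
        (by apply Continuous.intervalIntegrable; unfold humpLoad humpS; fun_prop),
    intervalIntegral.integral_const_mul, integral_humpLoad, integral_mul_humpLoad]
  unfold quarticMoment1; ring

/-- `M₂(a,b) = ∫_a^b (b - t)² p(t) dt`. -/
theorem quarticMoment2_eq_integral (r a b : ℝ) :
    ∫ t in a..b, (b - t) ^ 2 * humpLoad r t = quarticMoment2 r a b := by
  rw [intervalIntegral.integral_congr
        (g := fun t => b ^ 2 * humpLoad r t - 2 * b * (t * humpLoad r t) + t ^ 2 * humpLoad r t)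
        (fun t _ => by ring),
    integral_add (by apply Continuous.intervalIntegrable; unfold humpLoad humpS; fun_prop)
        (by apply Continuous.intervalIntegrable; unfold humpLoad humpS; fun_prop),
    integral_sub (by apply Continuous.intervalIntegrable; unfold humpLoad humpS; fun_prop)
        (by apply Continuous.intervalIntegrable; unfold humpLoad humpS; fun_prop),
    intervalIntegral.integral_const_mul, intervalIntegral.integral_const_mul,
    integral_humpLoad, integral_mul_humpLoad, integral_sq_mul_humpLoad]
  unfold quarticMoment2; ring

/-! ### The exact landing: all three moments vanish at `x₀ = -(2/3) r`, `x_e = r/2`, `r² = 6` -/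

/-- `M₀(x₀, x_e) = 0` at `x₀ = -(2/3) r`, `x_e = r/2`, `r² = 6`. -/
theorem quarticMoment0_landing (r : ℝ) (hr : r ^ 2 = 6) :
    quarticMoment0 r (-(2 / 3) * r) (r / 2) = 0 := by
  unfold quarticMoment0 humpPrim0
  linear_combination (-(203 : ℝ) / 2160 * r + 1267 / 38880 * r ^ 3) * hr

/-- `M₁(x₀, x_e) = 0` at `x₀ = -(2/3) r`, `x_e = r/2`, `r² = 6`. -/
theorem quarticMoment1_landing (r : ℝ) (hr : r ^ 2 = 6) :
    quarticMoment1 r (-(2 / 3) * r) (r / 2) = 0 := by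
  unfold quarticMoment1 humpPrim0 humpPrim1
  linear_combination (-(1421 : ℝ) / 25920 * r ^ 2 + 39641 / 1399680 * r ^ 4) * hr

/-- `M₂(x₀, x_e) = 0` at `x₀ = -(2/3) r`, `x_e = r/2`, `r² = 6`. -/
theorem quarticMoment2_landing (r : ℝ) (hr : r ^ 2 = 6) :
    quarticMoment2 r (-(2 / 3) * r) (r / 2) = 0 := by
  unfold quarticMoment2 humpPrim0 humpPrim1 humpPrim2
  linear_combination (-(9947 : ℝ) / 233280 * r ^ 3 + 41503 / 1399680 * r ^ 5) * hr

/-- **An exact quartic (neutral-leaf) landing exists in the two-hump model.**  For `r² = 6`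
(i.e. `r = √6`), the profile `S(t) = 31/60 - (t² - 1)² - (4r/45) t`, the lift-off point
`x₀ = -(2/3) r` and the contact `x_e = r/2` satisfy: `x_e` is a zero of `S`, the lift-off leaf is
stable, and the three landing moments `∫_{x₀}^{x_e} (x_e - t)^k (-S(t)) dt`, `k = 0,1,2`, vanish —
so `q(x) = ∫_{x₀}^{x} (x - t)²/2 · (-S(t)) dt` has `q = q' = q'' = q''' = 0` at `x_e`:
no velocity jump, no shear at the contact. -/
theorem quartic_landing_model (r : ℝ) (hr : r ^ 2 = 6) :
    humpS r (r / 2) = 0 ∧ humpS r (-(2 / 3) * r) < 0 ∧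
      (∫ t in (-(2 / 3) * r)..(r / 2), humpLoad r t) = 0 ∧
      (∫ t in (-(2 / 3) * r)..(r / 2), (r / 2 - t) * humpLoad r t) = 0 ∧
      (∫ t in (-(2 / 3) * r)..(r / 2), (r / 2 - t) ^ 2 * humpLoad r t) = 0 := by
  refine ⟨humpS_landing_zero r hr, ?_, ?_, ?_, ?_⟩
  · rw [humpS_liftoff r hr]; norm_num
  · rw [quarticMoment0_eq_integral, quarticMoment0_landing r hr]
  · rw [quarticMoment1_eq_integral, quarticMoment1_landing r hr]
  · rw [quarticMoment2_eq_integral, quarticMoment2_landing r hr]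

/-- The same statement at `r = √6`, together with the sign pattern of the profile. -/
theorem quartic_landing_sqrt6 :
    humpS (√6) (√6 / 2) = 0 ∧ humpS (√6) (-(2 / 3) * √6) < 0 ∧
      (∫ t in (-(2 / 3) * √6)..(√6 / 2), humpLoad (√6) t) = 0 ∧
      (∫ t in (-(2 / 3) * √6)..(√6 / 2), (√6 / 2 - t) * humpLoad (√6) t) = 0 ∧
      (∫ t in (-(2 / 3) * √6)..(√6 / 2), (√6 / 2 - t) ^ 2 * humpLoad (√6) t) = 0 ∧
      (0 < humpS (√6) (-1) ∧ humpS (√6) 0 < 0 ∧ 0 < humpS (√6) 1 ∧ humpS (√6) (3 / 2) < 0) ∧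
      0 < humpSlopeFactor (√6) (√6 / 2) := by
  have h6 : (√6 : ℝ) ^ 2 = 6 := Real.sq_sqrt (by norm_num)
  have hpos : (0 : ℝ) < √6 := Real.sqrt_pos.mpr (by norm_num)
  have hlt : (√6 : ℝ) < 3 := by nlinarith [h6, hpos]
  obtain ⟨h1, h2, h3, h4, h5⟩ := quartic_landing_model (√6) h6
  refine ⟨h1, h2, h3, h4, h5, humpS_sign_pattern (√6) hpos hlt, ?_⟩
  rw [humpSlopeFactor_at_landing (√6) h6]; positivity

end Summit.AnomalousDissipation.AnomalousDissipation.Theorems
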